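import Summits.KontsevichZagierPeriods.KontsevichZagierPeriods.Theorems.SoloInformedToricJacobian
import HarnessLib

/-!
# The Laurent integrability test on the open cube

Solo programme `solo-KontsevichZagierPeriods-informed`, session s104.

`soloInformed_le_of_integrableOn_laurent`: if a "Laurent polynomial"
`v ↦ (∑_{b ∈ s} c_b · v^{u_b}) / v^w` (`u_b ∈ ℕⁿ` pairwise distinct, `c_b ≠ 0`, `w ∈ ℕⁿ`) is
integrable on the open cube `(0,1)ⁿ`, then `w ≤ u_b` componentwise for EVERY `b ∈ s` — no
cancellation between distinct monomials can save integrability.  Proof: if `k₀ = min_b u_b(j) < w(j)`,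
the sum `g` of the terms with `u_b(j) = k₀` (with `x_j` deleted) is a non-zero polynomial, hence
non-zero at some point `z` of the open cube (`soloInformed_exists_eval_ne_zero`: identity theorem for
real-analytic functions), hence `|g| ≥ δ > 0` on a box around `z`; on that box times `(0, τ)` in the
`j`-th coordinate the integrand is `≥ (δ/2)/v_j`, whose integral diverges logarithmically
(`soloInformed_false_of_inv_le_abs`, Fubini over the box).  This is the analytic input for rational
integrands `P/Q` with numerators of mixed sign on the cube-nondegenerate toric sector.

References: elementary; A. G. Kouchnirenko, Invent. Math. 32 (1976) §1 (Newton data).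
-/

noncomputable section

open scoped BigOperators
open MeasureTheory Set

namespace Summit.KontsevichZagierPeriods.KontsevichZagierPeriods.Theorems

variable {n : ℕ}

/-- A non-zero real polynomial does not vanish identically on a non-empty open set (identity
theorem for real-analytic functions). [this work] -/
theorem soloInformed_exists_eval_ne_zero (G : MvPolynomial (Fin n) ℝ) (hG : G ≠ 0)
    {U : Set (Fin n → ℝ)} (hU : IsOpen U) (hne : U.Nonempty) :
    ∃ z ∈ U, MvPolynomial.eval z G ≠ 0 := by
  by_contra h
  push Not at h
  obtain ⟨z₀, hz₀⟩ := hne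
  have hA := AnalyticOnNhd.eval_mvPolynomial (𝕜 := ℝ) G
  have hev : (fun x => MvPolynomial.eval x G) =ᶠ[nhds z₀] 0 :=
    Filter.eventuallyEq_iff_exists_mem.2 ⟨U, hU.mem_nhds hz₀, fun x hx => h x hx⟩
  have hzero := hA.eqOn_zero_of_preconnected_of_eventuallyEq_zero isPreconnected_univ
    (Set.mem_univ z₀) hev
  exact hG (MvPolynomial.funext fun x => by simpa using hzero (Set.mem_univ x))

/-- `∫_{(t,τ)} dx/x = log(τ/t)` for `0 < t ≤ τ`. [this work] -/
theorem soloInformed_integral_inv_Ioo {t τ : ℝ} (ht : 0 < t) (htτ : t ≤ τ) :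
    ∫ x in Ioo t τ, x⁻¹ = Real.log (τ / t) := by
  rw [← integral_Ioc_eq_integral_Ioo, ← intervalIntegral.integral_of_le htτ,
    integral_inv_of_pos ht (ht.trans_le htτ)]

/-- **Logarithmic divergence.**  If `F` satisfies `C / y_j ≤ |F(y)|` (`C > 0`) for all `y` in the
open cube with `lo_k < y_k < hi_k` (`k ≠ j`, `0 ≤ lo_k < hi_k ≤ 1`) and `y_j < τ`, then `F` is not
integrable on the open cube: Fubini over the box `∏_{k ≠ j} (lo_k, hi_k) × (t, τ)` bounds
`∫ |F|` below by `C · ∏ (hi_k − lo_k) · log(τ/t)`, unbounded as `t → 0`. [this work] -/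
theorem soloInformed_false_of_inv_le_abs (F : (Fin n → ℝ) → ℝ) (j : Fin n) (lo hi : Fin n → ℝ)
    (hlo : ∀ k, 0 ≤ lo k) (hhi : ∀ k, hi k ≤ 1) (hlh : ∀ k, lo k < hi k) {τ C : ℝ}
    (hτ : 0 < τ) (hτ1 : τ ≤ 1) (hC : 0 < C)
    (hF : ∀ y ∈ Set.pi univ (fun _ : Fin n => Ioo (0 : ℝ) 1),
      (∀ k, k ≠ j → lo k < y k ∧ y k < hi k) → y j < τ → C * (y j)⁻¹ ≤ |F y|)
    (hint : IntegrableOn F (Set.pi univ fun _ : Fin n => Ioo (0 : ℝ) 1)) : False := by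
  classical
  have hmeasO : MeasurableSet (Set.pi univ fun _ : Fin n => Ioo (0 : ℝ) 1) :=
    MeasurableSet.univ_pi fun _ => measurableSet_Ioo
  have hIabs : IntegrableOn (fun y => |F y|) (Set.pi univ fun _ : Fin n => Ioo (0 : ℝ) 1) :=
    hint.abs
  obtain ⟨I, hI⟩ : ∃ I : ℝ, I = ∫ y in Set.pi univ (fun _ : Fin n => Ioo (0 : ℝ) 1), |F y| :=
    ⟨_, rfl⟩
  have hI0 : 0 ≤ I := by rw [hI]; exact setIntegral_nonneg hmeasO fun y _ => abs_nonneg _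
  obtain ⟨c, hc⟩ : ∃ c : ℝ, c = C * ∏ k ∈ Finset.univ.erase j, (hi k - lo k) := ⟨_, rfl⟩
  have hcpos : 0 < c := by
    rw [hc]; exact mul_pos hC (Finset.prod_pos fun k _ => sub_pos.2 (hlh k))
  -- the parameter `t` with `c · log(τ/t) = I + 1`
  obtain ⟨t, ht⟩ : ∃ t : ℝ, t = τ * Real.exp (-((I + 1) / c)) := ⟨_, rfl⟩
  have ht0 : 0 < t := by rw [ht]; exact mul_pos hτ (Real.exp_pos _)
  have htτ : t < τ := by
    have h1 : Real.exp (-((I + 1) / c)) < 1 :=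
      Real.exp_lt_one_iff.2 (neg_neg_iff_pos.2 (div_pos (by linarith) hcpos))
    calc t = τ * Real.exp (-((I + 1) / c)) := ht
      _ < τ * 1 := mul_lt_mul_of_pos_left h1 hτ
      _ = τ := mul_one τ
  have hlog : Real.log (τ / t) = (I + 1) / c := by
    rw [ht, ← div_div, div_self hτ.ne', one_div, Real.log_inv, Real.log_exp, neg_neg]
  -- the box
  obtain ⟨l, hl⟩ : ∃ l : Fin n → ℝ, l = fun k => if k = j then t else lo k := ⟨_, rfl⟩
  obtain ⟨h, hh⟩ : ∃ h : Fin n → ℝ, h = fun k => if k = j then τ else hi k := ⟨_, rfl⟩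
  have hlj : l j = t := by rw [hl]; simp
  have hhj : h j = τ := by rw [hh]; simp
  have hlk : ∀ k, k ≠ j → l k = lo k := fun k hk => by rw [hl]; simp [hk]
  have hhk : ∀ k, k ≠ j → h k = hi k := fun k hk => by rw [hh]; simp [hk]
  have hl0 : ∀ k, 0 ≤ l k := fun k => by
    by_cases hk : k = j
    · rw [hk, hlj]; exact ht0.le
    · rw [hlk k hk]; exact hlo k
  have hh1 : ∀ k, h k ≤ 1 := fun k => by
    by_cases hk : k = j
    · rw [hk, hhj]; exact hτ1
    · rw [hhk k hk]; exact hhi k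
  have hlh' : ∀ k, l k < h k := fun k => by
    by_cases hk : k = j
    · rw [hk, hlj, hhj]; exact htτ
    · rw [hlk k hk, hhk k hk]; exact hlh k
  have hBO : (Set.pi univ fun k => Ioo (l k) (h k)) ⊆ Set.pi univ fun _ : Fin n => Ioo (0 : ℝ) 1 :=
    Set.pi_mono fun k _ => Ioo_subset_Ioo (hl0 k) (hh1 k)
  have hmeasB : MeasurableSet (Set.pi univ fun k => Ioo (l k) (h k)) :=
    MeasurableSet.univ_pi fun _ => measurableSet_Ioo
  -- the test function `∏ₖ ψₖ(yₖ)`, `ψⱼ(x) = C/x`, `ψₖ = 1` (`k ≠ j`)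
  obtain ⟨ψ, hψ⟩ : ∃ ψ : Fin n → ℝ → ℝ, ψ = fun k x => if k = j then C * x⁻¹ else 1 := ⟨_, rfl⟩
  have hψj : ψ j = fun x => C * x⁻¹ := by rw [hψ]; simp
  have hψk : ∀ k, k ≠ j → ψ k = fun _ => 1 := fun k hk => by rw [hψ]; funext x; simp [hk]
  have hφ : ∀ y : Fin n → ℝ, (∏ k, ψ k (y k)) = C * (y j)⁻¹ := by
    intro y
    rw [← Finset.mul_prod_erase Finset.univ _ (Finset.mem_univ j), hψj,
      Finset.prod_eq_one (fun k hk => by rw [hψk k (Finset.ne_of_mem_erase hk)]), mul_one]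
  have hφF : ∀ y ∈ Set.pi univ (fun k => Ioo (l k) (h k)), (∏ k, ψ k (y k)) ≤ |F y| := by
    intro y hy
    rw [hφ]
    have hy' := mem_univ_pi.1 hy
    refine hF y (hBO hy) (fun k hk => ?_) ?_
    · have h1 := hy' k
      rw [hlk k hk, hhk k hk] at h1
      exact h1
    · have h1 := hy' j
      rw [hhj] at h1
      exact h1.2
  have hφm : Measurable fun y : Fin n → ℝ => ∏ k, ψ k (y k) := by
    refine Finset.measurable_prod _ fun k _ => ?_
    by_cases hk : k = j
    · rw [hk, hψj]; exact (measurable_inv.const_mul C).comp (measurable_pi_apply j)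
    · rw [hψk k hk]; exact measurable_const
  have hφ0 : ∀ y ∈ Set.pi univ (fun k => Ioo (l k) (h k)), 0 ≤ ∏ k, ψ k (y k) := by
    intro y hy
    rw [hφ]
    exact mul_nonneg hC.le (inv_nonneg.2 ((hl0 j).trans ((mem_univ_pi.1 hy) j).1.le))
  have hφint : IntegrableOn (fun y : Fin n → ℝ => ∏ k, ψ k (y k))
      (Set.pi univ fun k => Ioo (l k) (h k)) :=
    Integrable.mono' (hIabs.mono_set hBO) hφm.aestronglyMeasurable
      (ae_restrict_of_forall_mem hmeasB fun y hy => by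
        rw [Real.norm_eq_abs, abs_of_nonneg (hφ0 y hy)]; exact hφF y hy)
  -- Fubini over the box
  have hprod : ∫ y in Set.pi univ (fun k => Ioo (l k) (h k)), ∏ k, ψ k (y k) =
      ∏ k, ∫ x in Ioo (l k) (h k), ψ k x := by
    have hm : (volume : Measure (Fin n → ℝ)).restrict (Set.pi univ fun k => Ioo (l k) (h k)) =
        Measure.pi (fun k => (volume : Measure ℝ).restrict (Ioo (l k) (h k))) := by
      rw [volume_pi, Measure.restrict_pi_pi]
    rw [hm]
    exact integral_fintype_prod_eq_prod ψ
  have hfacj : ∫ x in Ioo (l j) (h j), ψ j x = C * Real.log (τ / t) := by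
    rw [hlj, hhj, hψj, integral_const_mul, soloInformed_integral_inv_Ioo ht0 htτ.le]
  have hfack : ∀ k ∈ Finset.univ.erase j, ∫ x in Ioo (l k) (h k), ψ k x = hi k - lo k := by
    intro k hk
    have hkj := Finset.ne_of_mem_erase hk
    rw [hlk k hkj, hhk k hkj, hψk k hkj, setIntegral_const, Real.volume_real_Ioo_of_le (hlh k).le,
      smul_eq_mul, mul_one]
  have hlow : c * Real.log (τ / t) =
      ∫ y in Set.pi univ (fun k => Ioo (l k) (h k)), ∏ k, ψ k (y k) := by
    rw [hprod, ← Finset.mul_prod_erase Finset.univ _ (Finset.mem_univ j), hfacj,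
      Finset.prod_congr rfl hfack, hc]
    ring
  -- upper bound and contradiction
  have hup : ∫ y in Set.pi univ (fun k => Ioo (l k) (h k)), ∏ k, ψ k (y k) ≤ I := by
    calc ∫ y in Set.pi univ (fun k => Ioo (l k) (h k)), ∏ k, ψ k (y k)
        ≤ ∫ y in Set.pi univ (fun k => Ioo (l k) (h k)), |F y| :=
          setIntegral_mono_on hφint (hIabs.mono_set hBO) hmeasB hφF
      _ ≤ I := by
          rw [hI]
          exact setIntegral_mono_set hIabs
            (ae_restrict_of_forall_mem hmeasO fun y _ => abs_nonneg _) hBO.eventuallyLE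
  rw [hlog, mul_div_cancel₀ _ hcpos.ne'] at hlow
  linarith

/-- **The Laurent integrability test.**  If `v ↦ (∑_{b ∈ s} c_b ∏ₖ v_k^{u_b(k)}) / ∏ₖ v_k^{w(k)}`
with `c_b ≠ 0` and pairwise distinct exponent vectors `u_b` is integrable on the open cube `(0,1)ⁿ`,
then `w ≤ u_b` componentwise for every `b ∈ s`. [this work] -/
theorem soloInformed_le_of_integrableOn_laurent {ι : Type*} (s : Finset ι) (c : ι → ℝ)
    (u : ι → Fin n → ℕ) (w : Fin n → ℕ) (hc : ∀ b ∈ s, c b ≠ 0)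
    (hu : ∀ b ∈ s, ∀ b' ∈ s, u b = u b' → b = b')
    (h : IntegrableOn (fun v : Fin n → ℝ => (∑ b ∈ s, c b * ∏ k, v k ^ u b k) / ∏ k, v k ^ w k)
      (Set.pi univ fun _ : Fin n => Ioo (0 : ℝ) 1)) :
    ∀ b ∈ s, ∀ j, w j ≤ u b j := by
  classical
  intro b₁ hb₁ j
  by_contra hlt
  push Not at hlt
  -- the minimal `j`-exponent `k₀ < w j` and the terms attaining it
  obtain ⟨bm, hbm, hmin⟩ := Finset.exists_min_image s (fun b => u b j) ⟨b₁, hb₁⟩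
  have hk₀w : u bm j + 1 ≤ w j := by have := hmin b₁ hb₁; omega
  have hbmS : bm ∈ s.filter fun b => u b j = u bm j := Finset.mem_filter.2 ⟨hbm, rfl⟩
  -- truncated exponents `e b := u b` with the `j`-th entry set to `0`
  obtain ⟨e, he⟩ : ∃ e : ι → Fin n → ℕ, e = fun b => Function.update (u b) j 0 := ⟨_, rfl⟩
  have hej : ∀ b, e b j = 0 := fun b => by rw [he]; simp
  have hek : ∀ b k, k ≠ j → e b k = u b k := fun b k hk => by rw [he]; simp [hk]
  have heinj : ∀ b ∈ s.filter (fun b => u b j = u bm j), ∀ b' ∈ s.filter (fun b => u b j = u bm j),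
      e b = e b' → b = b' := by
    intro b hb b' hb' hbb'
    refine hu b (Finset.mem_filter.1 hb).1 b' (Finset.mem_filter.1 hb').1 (funext fun k => ?_)
    by_cases hk : k = j
    · rw [hk, (Finset.mem_filter.1 hb).2, (Finset.mem_filter.1 hb').2]
    · rw [← hek b k hk, ← hek b' k hk, hbb']
  -- the polynomial `G := ∑_{b : u_b(j) = k₀} c_b X^{e b}` is non-zero ...
  obtain ⟨G, hG⟩ : ∃ G : MvPolynomial (Fin n) ℝ, G = ∑ b ∈ s.filter (fun b => u b j = u bm j),
      MvPolynomial.monomial (Finsupp.equivFunOnFinite.symm (e b)) (c b) := ⟨_, rfl⟩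
  have hGeval : ∀ y : Fin n → ℝ, MvPolynomial.eval y G =
      ∑ b ∈ s.filter (fun b => u b j = u bm j), c b * ∏ k, y k ^ e b k := by
    intro y
    rw [hG, map_sum]
    refine Finset.sum_congr rfl fun b _ => ?_
    rw [MvPolynomial.eval_monomial, Finsupp.prod_pow]
    simp only [Finsupp.coe_equivFunOnFinite_symm]
  have hG0 : G ≠ 0 := by
    intro h0
    have h1 : MvPolynomial.coeff (Finsupp.equivFunOnFinite.symm (e bm)) G = c bm := by
      rw [hG, MvPolynomial.coeff_sum]
      simp only [MvPolynomial.coeff_monomial]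
      rw [Finset.sum_eq_single bm (fun b hb hbne => if_neg fun hEq => hbne
        (heinj b hb bm hbmS (Finsupp.equivFunOnFinite.symm.injective hEq))) fun hn => (hn hbmS).elim,
        if_pos rfl]
    rw [h0, MvPolynomial.coeff_zero] at h1
    exact hc bm hbm h1.symm
  -- ... hence non-zero at a point `z` of the open cube, and `|G| ≥ δ` on a box around `z`
  have hOo : IsOpen (Set.pi univ fun _ : Fin n => Ioo (0 : ℝ) 1) :=
    isOpen_set_pi finite_univ fun _ _ => isOpen_Ioo
  obtain ⟨z, hzO, hz⟩ := soloInformed_exists_eval_ne_zero G hG0 hOo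
    ⟨fun _ => 1 / 2, mem_univ_pi.2 fun _ => ⟨by norm_num, by norm_num⟩⟩
  obtain ⟨δ, hδ⟩ : ∃ δ : ℝ, δ = |MvPolynomial.eval z G| / 2 := ⟨_, rfl⟩
  have hδ0 : 0 < δ := by rw [hδ]; exact half_pos (abs_pos.2 hz)
  obtain ⟨ρ₁, hρ₁, hcont⟩ := Metric.continuous_iff.1 (MvPolynomial.continuous_eval G) z δ hδ0
  obtain ⟨ε, hε, hball⟩ := Metric.isOpen_iff.1 hOo z hzO
  obtain ⟨ρ, hρ⟩ : ∃ ρ : ℝ, ρ = min ρ₁ ε / 2 := ⟨_, rfl⟩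
  have hρ0 : 0 < ρ := by rw [hρ]; exact half_pos (lt_min hρ₁ hε)
  have hρρ₁ : ρ < ρ₁ := by
    rw [hρ]; exact (half_lt_self (lt_min hρ₁ hε)).trans_le (min_le_left _ _)
  have hρε : ρ < ε := by
    rw [hρ]; exact (half_lt_self (lt_min hρ₁ hε)).trans_le (min_le_right _ _)
  have hg : ∀ y : Fin n → ℝ, (∀ k, k ≠ j → z k - ρ < y k ∧ y k < z k + ρ) →
      δ ≤ |∑ b ∈ s.filter (fun b => u b j = u bm j), c b * ∏ k, y k ^ e b k| := by
    intro y hy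
    have hd : dist (Function.update y j (z j)) z < ρ₁ := by
      refine lt_of_le_of_lt ((dist_pi_le_iff hρ0.le).2 fun k => ?_) hρρ₁
      by_cases hk : k = j
      · rw [hk, Function.update_self, dist_self]; exact hρ0.le
      · rw [Function.update_of_ne hk, Real.dist_eq, abs_le]
        constructor <;> linarith [hy k hk]
    have h1 := hcont _ hd
    rw [Real.dist_eq] at h1
    have h2 : ∑ b ∈ s.filter (fun b => u b j = u bm j), c b * ∏ k, y k ^ e b k =
        MvPolynomial.eval (Function.update y j (z j)) G := by
      rw [hGeval]
      refine Finset.sum_congr rfl fun b _ => ?_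
      congr 1
      refine Finset.prod_congr rfl fun k _ => ?_
      by_cases hk : k = j
      · rw [hk, hej, pow_zero, pow_zero]
      · rw [Function.update_of_ne hk]
    rw [h2]
    have h3 : |MvPolynomial.eval z G| = 2 * δ := by rw [hδ]; ring
    have h4 := abs_sub_abs_le_abs_sub (MvPolynomial.eval z G)
      (MvPolynomial.eval (Function.update y j (z j)) G)
    rw [abs_sub_comm] at h4
    linarith
  -- the box `∏_{k} (z_k − ρ, z_k + ρ)` lies in the open cube
  have hzρ : ∀ k, 0 < z k - ρ ∧ z k + ρ < 1 := by
    intro k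
    have hm : ∀ σ : ℝ, |σ| = ρ → Function.update z k (z k + σ) ∈
        Set.pi univ fun _ : Fin n => Ioo (0 : ℝ) 1 := by
      intro σ hσ
      refine hball (Metric.mem_ball.2 ?_)
      refine lt_of_le_of_lt ((dist_pi_le_iff hρ0.le).2 fun k' => ?_) hρε
      by_cases hk : k' = k
      · rw [hk, Function.update_self, Real.dist_eq, add_sub_cancel_left, hσ]
      · rw [Function.update_of_ne hk, dist_self]; exact hρ0.le
    have h1 := (mem_univ_pi.1 (hm (-ρ) (by rw [abs_neg, abs_of_pos hρ0]))) k
    have h2 := (mem_univ_pi.1 (hm ρ (abs_of_pos hρ0))) k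
    rw [Function.update_self] at h1 h2
    exact ⟨by simpa using h1.1, h2.2⟩
  -- constants
  obtain ⟨M, hM⟩ : ∃ M : ℝ, M = ∑ b ∈ s, |c b| := ⟨_, rfl⟩
  have hM0 : 0 ≤ M := by rw [hM]; exact Finset.sum_nonneg fun b _ => abs_nonneg _
  obtain ⟨τ, hτ⟩ : ∃ τ : ℝ, τ = min (1 / 2) (δ / (2 * M + 1)) := ⟨_, rfl⟩
  have hτ0 : 0 < τ := by rw [hτ]; exact lt_min (by norm_num) (div_pos hδ0 (by linarith))
  have hτ1 : τ ≤ 1 := by rw [hτ]; exact (min_le_left _ _).trans (by norm_num)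
  have hMτ : M * τ ≤ δ / 2 := by
    have h1 : τ ≤ δ / (2 * M + 1) := by rw [hτ]; exact min_le_right _ _
    calc M * τ ≤ M * (δ / (2 * M + 1)) := mul_le_mul_of_nonneg_left h1 hM0
      _ ≤ δ / 2 := by
          rw [mul_div_assoc', div_le_div_iff₀ (by linarith) (by norm_num : (0 : ℝ) < 2)]
          nlinarith
  -- the pointwise lower bound `(δ/2)/y_j ≤ |F(y)|` near the face `y_j = 0` over the box
  refine soloInformed_false_of_inv_le_abs _ j (fun k => z k - ρ) (fun k => z k + ρ)
    (fun k => (hzρ k).1.le) (fun k => (hzρ k).2.le) (fun k => by linarith) hτ0 hτ1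
    (half_pos hδ0) (fun y hyO hyk hyj => ?_) h
  have hy0 : ∀ k, 0 < y k ∧ y k < 1 := fun k => (mem_univ_pi.1 hyO) k
  -- `m b := ∏ₖ y_k^{e b k} ∈ [0, 1]` and `y^{u b} = y_j^{u b j} · m b`
  have hm01 : ∀ b, 0 ≤ (∏ k, y k ^ e b k) ∧ (∏ k, y k ^ e b k) ≤ 1 := fun b =>
    ⟨Finset.prod_nonneg fun k _ => pow_nonneg (hy0 k).1.le _,
      Finset.prod_le_one (fun k _ => pow_nonneg (hy0 k).1.le _)
        fun k _ => pow_le_one₀ (hy0 k).1.le (hy0 k).2.le⟩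
  have hsplit : ∀ b, (∏ k, y k ^ u b k) = y j ^ u b j * ∏ k, y k ^ e b k := by
    intro b
    rw [← Finset.mul_prod_erase Finset.univ (fun k => y k ^ u b k) (Finset.mem_univ j),
      ← Finset.mul_prod_erase Finset.univ (fun k => y k ^ e b k) (Finset.mem_univ j), hej,
      pow_zero, one_mul]
    exact congrArg _ (Finset.prod_congr rfl fun k hk => by rw [hek b k (Finset.ne_of_mem_erase hk)])
  -- `N(y) = y_j^{k₀} · (g(y) + R(y))` with `|R(y)| ≤ M · y_j`
  have hN : ∑ b ∈ s, c b * ∏ k, y k ^ u b k = y j ^ u bm j *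
      ((∑ b ∈ s.filter (fun b => u b j = u bm j), c b * ∏ k, y k ^ e b k) +
        ∑ b ∈ s.filter (fun b => ¬ u b j = u bm j),
          c b * (y j ^ (u b j - u bm j) * ∏ k, y k ^ e b k)) := by
    have h1 : ∑ b ∈ s, c b * ∏ k, y k ^ u b k =
        ∑ b ∈ s, y j ^ u bm j * (c b * (y j ^ (u b j - u bm j) * ∏ k, y k ^ e b k)) := by
      refine Finset.sum_congr rfl fun b hb => ?_
      rw [hsplit b, ← Nat.add_sub_cancel' (hmin b hb), pow_add, Nat.add_sub_cancel_left]
      ring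
    rw [h1, ← Finset.mul_sum, ← Finset.sum_filter_add_sum_filter_not s (fun b => u b j = u bm j)]
    congr 2
    refine Finset.sum_congr rfl fun b hb => ?_
    rw [(Finset.mem_filter.1 hb).2, Nat.sub_self, pow_zero, one_mul]
  have hR : |∑ b ∈ s.filter (fun b => ¬ u b j = u bm j),
      c b * (y j ^ (u b j - u bm j) * ∏ k, y k ^ e b k)| ≤ M * y j := by
    refine (Finset.abs_sum_le_sum_abs _ _).trans ?_
    have h1 : ∀ b ∈ s.filter (fun b => ¬ u b j = u bm j),
        |c b * (y j ^ (u b j - u bm j) * ∏ k, y k ^ e b k)| ≤ |c b| * y j := by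
      intro b hb
      have hb' := Finset.mem_filter.1 hb
      have hd : 1 ≤ u b j - u bm j := by
        have := hmin b hb'.1
        have : u bm j < u b j := lt_of_le_of_ne this (Ne.symm hb'.2)
        omega
      rw [abs_mul, abs_of_nonneg (mul_nonneg (pow_nonneg (hy0 j).1.le _) (hm01 b).1)]
      refine mul_le_mul_of_nonneg_left ?_ (abs_nonneg _)
      calc y j ^ (u b j - u bm j) * ∏ k, y k ^ e b k ≤ y j ^ 1 * 1 :=
            mul_le_mul (pow_le_pow_of_le_one (hy0 j).1.le (hy0 j).2.le hd) (hm01 b).2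
              (hm01 b).1 (pow_nonneg (hy0 j).1.le _)
        _ = y j := by rw [pow_one, mul_one]
    refine (Finset.sum_le_sum h1).trans ?_
    rw [← Finset.sum_mul, hM]
    exact mul_le_mul_of_nonneg_right
      (Finset.sum_le_sum_of_subset_of_nonneg (Finset.filter_subset _ _)
        fun b _ _ => abs_nonneg _) (hy0 j).1.le
  have hgy := hg y hyk
  -- `|N(y)| ≥ y_j^{k₀} · δ/2`
  have hT : δ / 2 ≤ |(∑ b ∈ s.filter (fun b => u b j = u bm j), c b * ∏ k, y k ^ e b k) +
      ∑ b ∈ s.filter (fun b => ¬ u b j = u bm j),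
        c b * (y j ^ (u b j - u bm j) * ∏ k, y k ^ e b k)| := by
    have h1 := abs_sub_abs_le_abs_sub
      (∑ b ∈ s.filter (fun b => u b j = u bm j), c b * ∏ k, y k ^ e b k)
      (-(∑ b ∈ s.filter (fun b => ¬ u b j = u bm j),
        c b * (y j ^ (u b j - u bm j) * ∏ k, y k ^ e b k)))
    rw [abs_neg, sub_neg_eq_add] at h1
    have h2 : M * y j ≤ δ / 2 := (mul_le_mul_of_nonneg_left hyj.le hM0).trans hMτ
    linarith
  have hNabs : y j ^ u bm j * (δ / 2) ≤ |∑ b ∈ s, c b * ∏ k, y k ^ u b k| := by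
    rw [hN, abs_mul, abs_of_nonneg (pow_nonneg (hy0 j).1.le _)]
    exact mul_le_mul_of_nonneg_left hT (pow_nonneg (hy0 j).1.le _)
  -- the denominator: `∏ₖ y_k^{w k} ≤ y_j^{w j}`
  have hW0 : 0 < ∏ k, y k ^ w k := Finset.prod_pos fun k _ => pow_pos (hy0 k).1 _
  have hWle : (∏ k, y k ^ w k) ≤ y j ^ w j := by
    rw [← Finset.mul_prod_erase Finset.univ (fun k => y k ^ w k) (Finset.mem_univ j)]
    exact (mul_le_mul_of_nonneg_left (Finset.prod_le_one (fun k _ => pow_nonneg (hy0 k).1.le _)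
      fun k _ => pow_le_one₀ (hy0 k).1.le (hy0 k).2.le) (pow_nonneg (hy0 j).1.le _)).trans
      (mul_one _).le
  -- assemble: `(δ/2)/y_j ≤ (δ/2) y_j^{k₀}/y_j^{w j} ≤ |N|/y^w = |F y|`
  have hpow : (y j)⁻¹ ≤ y j ^ u bm j / y j ^ w j := by
    rw [inv_eq_one_div, div_le_div_iff₀ (hy0 j).1 (pow_pos (hy0 j).1 _), one_mul, ← pow_succ]
    exact pow_le_pow_of_le_one (hy0 j).1.le (hy0 j).2.le hk₀w
  rw [abs_div, abs_of_pos hW0]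
  calc δ / 2 * (y j)⁻¹ ≤ δ / 2 * (y j ^ u bm j / y j ^ w j) :=
        mul_le_mul_of_nonneg_left hpow (half_pos hδ0).le
    _ = y j ^ u bm j * (δ / 2) / y j ^ w j := by ring
    _ ≤ |∑ b ∈ s, c b * ∏ k, y k ^ u b k| / y j ^ w j :=
        div_le_div_of_nonneg_right hNabs (pow_nonneg (hy0 j).1.le _)
    _ ≤ |∑ b ∈ s, c b * ∏ k, y k ^ u b k| / ∏ k, y k ^ w k :=
        div_le_div_of_nonneg_left (abs_nonneg _) hW0 hWle

end Summit.KontsevichZagierPeriods.KontsevichZagierPeriods.Theorems
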